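import Mathlib
import Summits.Ventures.PercRepro2.Defs
import Summits.Ventures.PercRepro2.Independence
import Summits.Ventures.PercRepro2.Harris
import Summits.Ventures.PercRepro2.Graph
import Summits.Ventures.PercRepro2.Events
import Summits.Ventures.PercRepro2.PartitionThree
import Summits.Ventures.PercRepro2.ZCTwoEdge
import Summits.Ventures.PercRepro2.ZCLeafReductions

/-!
# The leaf reductions of (ZC) on the graph: a pendant `o` (or `a₃`) reduces (ZC) to `G − o`
(blind cell PercRepro2, mine-a g23; MINE-A.md §70.4)

The graph instances of `zc_leaf_o` and `zc_leaf_a3`.  A LEAF `ℓ` is a vertex whose only edge is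
`f = zℓ` (`hleaf : ∀ e, ℓ ∈ ends e → e = f`); `ω⁻ := ω[f ↦ closed]` is the configuration of
`G − ℓ`, and `P_{p[f ↦ 0]}` is percolation on `G − ℓ`.  The structural lemma is `cluster_leaf_eq`:
for `x ≠ ℓ`, `C(x) = C⁻(x) ∪ ({ℓ} if f open and z ∈ C⁻(x))`.
* `zc_leaf_o_graph`: `o` a leaf at `z`; for every up-set `𝓔`,
  `(ZC)_p(a₁, a₃, o; 𝓔) ≥ p f · (ZC)_{p[f↦0]}(a₁, a₃, z; 𝓔_z)`, `𝓔_z = {S ∣ (z ∈ S ∧ insert o S ∈ 𝓔) ∨ (z ∉ S ∧ S ∈ 𝓔)}`;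
* `zc_leaf_a3_graph`: `a₃` a leaf at `z'`; `(ZC)_p(a₁, a₃, o; 𝓔) ≥ (p f)² · (ZC)_{p[f↦0]}(a₁, z', o; 𝓔_{z'})`.
The (P1) input is the cell's `partitionThree_lattice` on `G − ℓ`.  Hence the class of graphs on
which (ZC) holds for every up-set is closed under attaching the marks `o`, `a₃` as leaves.  One seat.
-/

namespace Summit.Ventures.PercRepro2

section CloseOne

variable {E : Type*} [DecidableEq E]

/-- Closing one edge is monotone: `ω⁻ ≤ ω`. -/
lemma closeOne_le (f : E) (ω : Config E) : Function.update ω f false ≤ ω := by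
  intro e
  by_cases h : e = f
  · subst h; simp
  · rw [Function.update_of_ne h]

/-- `ω⁻` is monotone in `ω`. -/
lemma closeOne_mono (f : E) {ω ω' : Config E} (h : ω ≤ ω') :
    Function.update ω f false ≤ Function.update ω' f false := by
  intro e
  by_cases he : e = f
  · subst he; simp
  · rw [Function.update_of_ne he, Function.update_of_ne he]; exact h e

/-- `ω⁻` ignores forcing `f`. -/
lemma closeOne_update (f : E) (ω : Config E) (b : Bool) :
    Function.update (Function.update ω f b) f false = Function.update ω f false :=
  Function.update_idem ..

/-- Pulling back an intersection along `ω ↦ ω⁻`. -/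
lemma closeOne_setOf_inter (f : E) (A B : Set (Config E)) :
    {ω : Config E | Function.update ω f false ∈ A ∩ B}
      = {ω | Function.update ω f false ∈ A} ∩ {ω | Function.update ω f false ∈ B} := rfl

/-- Pulling back a complement along `ω ↦ ω⁻`. -/
lemma closeOne_setOf_compl (f : E) (A : Set (Config E)) :
    {ω : Config E | Function.update ω f false ∈ Aᶜ} = {ω | Function.update ω f false ∈ A}ᶜ := rfl

end CloseOne

section Leaf

variable {V : Type*} {E : Type*} [DecidableEq E] {ends : E → Sym2 V} {z ℓ : V} {f : E}

/-- A leaf is isolated in `ω⁻`: no cluster of a vertex `x ≠ ℓ` contains `ℓ`. -/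
lemma leaf_not_mem_cluster_closeOne (hleaf : ∀ e, ℓ ∈ ends e → e = f) (ω : Config E) {x : V}
    (hx : x ≠ ℓ) : ℓ ∉ cluster ends (Function.update ω f false) x := by
  intro hmem
  have hS : ∀ v ∈ {v : V | v ≠ ℓ}, ∀ y,
      (openGraph ends (Function.update ω f false)).Adj v y → y ∈ {v : V | v ≠ ℓ} := by
    intro v _ y hvy
    rw [openGraph_adj] at hvy
    obtain ⟨_, e, he, hends⟩ := hvy
    intro hy
    rw [hy] at hends
    have hl : ℓ ∈ ends e := by rw [hends]; exact Sym2.mem_mk_right _ _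
    have := hleaf e hl
    subst this
    simp at he
  exact (mem_of_conn_of_closed hS hx hmem) rfl

/-- **The cluster of a non-leaf vertex**: `C(x) = C⁻(x) ∪ ({ℓ} if f open and z ∈ C⁻(x))`. -/
lemma cluster_leaf_eq (hends : ends f = s(z, ℓ)) (hleaf : ∀ e, ℓ ∈ ends e → e = f) (hzℓ : z ≠ ℓ)
    (ω : Config E) {x : V} (hx : x ≠ ℓ) :
    cluster ends ω x = cluster ends (Function.update ω f false) x
      ∪ {u | u = ℓ ∧ ω f = true ∧ z ∈ cluster ends (Function.update ω f false) x} := by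
  have hnot := leaf_not_mem_cluster_closeOne hleaf ω hx
  ext u
  constructor
  · intro hu
    refine mem_of_conn_of_closed (S := cluster ends (Function.update ω f false) x
      ∪ {u | u = ℓ ∧ ω f = true ∧ z ∈ cluster ends (Function.update ω f false) x}) ?_
      (Or.inl (mem_cluster_self _ _ _)) hu
    intro v hv y hvy
    rw [openGraph_adj] at hvy
    obtain ⟨hne, e, he, hends'⟩ := hvy
    by_cases hef : e = f
    · subst hef
      rw [hends] at hends'
      rcases Sym2.eq_iff.1 hends' with ⟨hv', hy'⟩ | ⟨hv', hy'⟩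
      · -- `v = z`, `y = ℓ`
        subst hv'; subst hy'
        rcases hv with hv | ⟨hv, _⟩
        · exact Or.inr ⟨rfl, he, hv⟩
        · exact absurd hv hzℓ
      · -- `v = ℓ`, `y = z`
        subst hv'; subst hy'
        rcases hv with hv | ⟨_, _, hz⟩
        · exact absurd hv hnot
        · exact Or.inl hz
    · have he' : Function.update ω f false e = true := by
        rw [Function.update_of_ne hef]; exact he
      rcases hv with hv | ⟨hv, _, _⟩
      · exact Or.inl (mem_cluster_of_adj hv (openGraph_adj.2 ⟨hne, e, he', hends'⟩))
      · exfalso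
        have hl : v ∈ ends e := by rw [hends']; exact Sym2.mem_mk_left _ _
        rw [hv] at hl
        exact hef (hleaf e hl)
  · rintro (hu | ⟨hu, hf, hz⟩)
    · exact cluster_mono (closeOne_le f ω) x hu
    · subst hu
      exact conn_trans (conn_mono (closeOne_le f ω) hz) (conn_of_openAdj ⟨f, hf, hends⟩)

/-- `{x ↔ y} = {x ↔ y in ω⁻}` for `x, y ≠ ℓ`. -/
lemma conn_leaf_iff_of_ne (hends : ends f = s(z, ℓ)) (hleaf : ∀ e, ℓ ∈ ends e → e = f)
    (hzℓ : z ≠ ℓ) (ω : Config E) {x y : V} (hx : x ≠ ℓ) (hy : y ≠ ℓ) :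
    Conn ends ω x y ↔ Conn ends (Function.update ω f false) x y := by
  have h := cluster_leaf_eq hends hleaf hzℓ ω hx
  constructor
  · intro hc
    have : y ∈ cluster ends ω x := hc
    rw [h] at this
    rcases this with hmem | ⟨hyl, _⟩
    · exact hmem
    · exact absurd hyl hy
  · intro hc
    exact conn_mono (closeOne_le f ω) hc

/-- `{x ↔ ℓ} = {f open} ∩ {x ↔ z in ω⁻}` for `x ≠ ℓ`. -/
lemma conn_leaf_iff (hends : ends f = s(z, ℓ)) (hleaf : ∀ e, ℓ ∈ ends e → e = f) (hzℓ : z ≠ ℓ)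
    (ω : Config E) {x : V} (hx : x ≠ ℓ) :
    Conn ends ω x ℓ ↔ ω f = true ∧ Conn ends (Function.update ω f false) x z := by
  have h := cluster_leaf_eq hends hleaf hzℓ ω hx
  have hnot := leaf_not_mem_cluster_closeOne hleaf ω hx
  constructor
  · intro hc
    have : ℓ ∈ cluster ends ω x := hc
    rw [h] at this
    rcases this with hmem | ⟨_, hf, hz⟩
    · exact absurd hmem hnot
    · exact ⟨hf, hz⟩
  · rintro ⟨hf, hz⟩
    exact conn_trans (conn_mono (closeOne_le f ω) hz) (conn_of_openAdj ⟨f, hf, hends⟩)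

end Leaf

section PartitionSets

variable {V : Type*} {E : Type*} {ends : E → Sym2 V}

/-- `bc ∩ abᶜ = abᶜ ∩ acᶜ ∩ bc` (on `b ↔ c`, `a ↮ b` forces `a ↮ c`). -/
lemma partBCa_eq_three (a b c : V) :
    partBCa ends a b c = (connEvent ends a b)ᶜ ∩ (connEvent ends a c)ᶜ ∩ connEvent ends b c := by
  ext ω
  simp only [partBCa, Set.mem_inter_iff, Set.mem_compl_iff, mem_connEvent]
  constructor
  · rintro ⟨hbc, hab⟩
    exact ⟨⟨hab, fun hac => hab (conn_trans hac (conn_symm hbc))⟩, hbc⟩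
  · rintro ⟨⟨hab, _⟩, hbc⟩
    exact ⟨hbc, hab⟩

/-- `ab ∩ bc = ab ∩ ac`. -/
lemma partAll_eq_ab_ac (a b c : V) :
    partAll ends a b c = connEvent ends a b ∩ connEvent ends a c := by
  ext ω
  simp only [partAll, Set.mem_inter_iff, mem_connEvent]
  constructor
  · rintro ⟨hab, hbc⟩; exact ⟨hab, conn_trans hab hbc⟩
  · rintro ⟨hab, hac⟩; exact ⟨hab, conn_trans (conn_symm hab) hac⟩

end PartitionSets

section LeafGraph

variable {V : Type*} {E : Type*} [Fintype E] [DecidableEq E] {R : Type*} [CommRing R]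
  [LinearOrder R] [IsStrictOrderedRing R]

/-- **(L_o) on the graph.**  `o` a leaf at `z` through `f`; `𝓔` an up-set.  With
`p' = p[f ↦ 0]` (percolation on `G − o`) and `𝓔_z = {S ∣ (z ∈ S ∧ insert o S ∈ 𝓔) ∨ (z ∉ S ∧ S ∈ 𝓔)}`:
  `(ZC)_p(a₁, a₃, o; 𝓔) ≥ p f · (ZC)_{p'}(a₁, a₃, z; 𝓔_z)`. -/
theorem zc_leaf_o_graph {p : E → R} (hp : IsProbVec p) {ends : E → Sym2 V} {a₁ a₃ o z : V}
    {f : E} (hends : ends f = s(z, o)) (hleaf : ∀ e, o ∈ ends e → e = f) (ho1 : o ≠ a₁)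
    (ho3 : o ≠ a₃) (hoz : o ≠ z) {𝓔 : Set (Set V)} (h𝓔 : IsUpperSet 𝓔) :
    let e := connEvent ends a₁ a₃
    let L := connEvent ends a₁ o
    let U := clusterInEvent ends a₁ 𝓔
    let γ := connEvent ends a₃ o
    let p' := Function.update p f 0
    let 𝓔z : Set (Set V) := {S | (z ∈ S ∧ insert o S ∈ 𝓔) ∨ (z ∉ S ∧ S ∈ 𝓔)}
    let e' := connEvent ends a₁ a₃
    let L' := connEvent ends a₁ z
    let U' := clusterInEvent ends a₁ 𝓔z
    let γ' := connEvent ends a₃ z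
    prob p (eᶜ ∩ Lᶜ ∩ γᶜ) * (prob p (U ∩ (e ∩ L)) - prob p U * prob p (e ∩ L))
      - prob p (eᶜ ∩ Lᶜ ∩ γ) * (prob p (U ∩ (e ∩ Lᶜ)) - prob p U * prob p (e ∩ Lᶜ))
      ≥ p f * (prob p' (e'ᶜ ∩ L'ᶜ ∩ γ'ᶜ) * (prob p' (U' ∩ (e' ∩ L')) - prob p' U' * prob p' (e' ∩ L'))
          - prob p' (e'ᶜ ∩ L'ᶜ ∩ γ') * (prob p' (U' ∩ (e' ∩ L'ᶜ)) - prob p' U' * prob p' (e' ∩ L'ᶜ))) := by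
  intro e L U γ p' 𝓔z e' L' U' γ'
  have hzo : z ≠ o := Ne.symm hoz
  -- the `ω⁻`-events
  set E' : Set (Config E) := {ω | Function.update ω f false ∈ e'} with hE'
  set Lz : Set (Config E) := {ω | Function.update ω f false ∈ L'} with hLz
  set γz : Set (Config E) := {ω | Function.update ω f false ∈ γ'} with hγz
  set X₀ : Set (Config E) := {ω | Function.update ω f false ∈ U} with hX₀
  set Xz : Set (Config E) := {ω | Function.update ω f false ∈ U'} with hXz
  -- the graph events in the abstract form
  have he : e = E' := by
    ext ω
    simp only [e, E', e', Set.mem_setOf_eq, mem_connEvent]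
    exact conn_leaf_iff_of_ne hends hleaf hzo ω (Ne.symm ho1) (Ne.symm ho3)
  have hL : L = openEdge f ∩ Lz := by
    ext ω
    simp only [L, Lz, L', Set.mem_inter_iff, Set.mem_setOf_eq, mem_connEvent, mem_openEdge]
    exact conn_leaf_iff hends hleaf hzo ω (Ne.symm ho1)
  have hγ : γ = openEdge f ∩ γz := by
    ext ω
    simp only [γ, γz, γ', Set.mem_inter_iff, Set.mem_setOf_eq, mem_connEvent, mem_openEdge]
    exact conn_leaf_iff hends hleaf hzo ω (Ne.symm ho3)
  have hU : U = (openEdge f ∩ Xz) ∪ (closedEdge f ∩ X₀) := by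
    ext ω
    simp only [U, Xz, X₀, U', 𝓔z, Set.mem_union, Set.mem_inter_iff, Set.mem_setOf_eq,
      mem_clusterInEvent, mem_openEdge, mem_closedEdge]
    rw [cluster_leaf_eq hends hleaf hzo ω (Ne.symm ho1)]
    rcases Bool.eq_false_or_eq_true (ω f) with hf | hf
    · by_cases hz : z ∈ cluster ends (Function.update ω f false) a₁
      · have hset : cluster ends (Function.update ω f false) a₁
            ∪ {u | u = o ∧ ω f = true ∧ z ∈ cluster ends (Function.update ω f false) a₁}
            = insert o (cluster ends (Function.update ω f false) a₁) := by
          ext u; simp [hf, hz]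
        rw [hset]; simp [hf, hz]
      · have hset : cluster ends (Function.update ω f false) a₁
            ∪ {u | u = o ∧ ω f = true ∧ z ∈ cluster ends (Function.update ω f false) a₁}
            = cluster ends (Function.update ω f false) a₁ := by
          ext u; simp [hz]
        rw [hset]; simp [hf, hz]
    · have hset : cluster ends (Function.update ω f false) a₁
          ∪ {u | u = o ∧ ω f = true ∧ z ∈ cluster ends (Function.update ω f false) a₁}
          = cluster ends (Function.update ω f false) a₁ := by
        ext u; simp [hf]
      rw [hset]; simp [hf]
  -- invariance under forcing `f`
  have inv : ∀ (A : Set (Config E)) (ω : Config E) (b : Bool),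
      Function.update ω f b ∈ {ω | Function.update ω f false ∈ A} ↔
        ω ∈ {ω | Function.update ω f false ∈ A} := by
    intro A ω b; simp only [Set.mem_setOf_eq, closeOne_update]
  -- monotonicity
  have hE'up : IsUpperSet E' := fun ω ω' hle hω => conn_mono (closeOne_mono f hle) hω
  have hLzup : IsUpperSet Lz := fun ω ω' hle hω => conn_mono (closeOne_mono f hle) hω
  have h𝓔zup : IsUpperSet 𝓔z := by
    intro S S' hSS' hS
    rcases hS with ⟨hzS, hS⟩ | ⟨hzS, hS⟩
    · exact Or.inl ⟨hSS' hzS, h𝓔 (Set.insert_subset_insert hSS') hS⟩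
    · by_cases hz' : z ∈ S'
      · exact Or.inl ⟨hz', h𝓔 ((hSS'.trans (Set.subset_insert _ _))) hS⟩
      · exact Or.inr ⟨hz', h𝓔 hSS' hS⟩
  have hXzup : IsUpperSet Xz := fun ω ω' hle hω =>
    h𝓔zup (cluster_mono (closeOne_mono f hle) a₁) hω
  have hX : X₀ ⊆ Xz := by
    intro ω hω
    simp only [Xz, X₀, U, U', 𝓔z, Set.mem_setOf_eq, mem_clusterInEvent] at hω ⊢
    by_cases hz : z ∈ cluster ends (Function.update ω f false) a₁
    · exact Or.inl ⟨hz, h𝓔 (Set.subset_insert _ _) hω⟩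
    · exact Or.inr ⟨hz, hω⟩
  -- (P1) on `G − o` for the marks `(a₁, a₃, z)`
  have hp' : IsProbVec p' := hp.update f le_rfl zero_le_one
  have hP1 : prob p (E'ᶜ ∩ Lzᶜ ∩ γz) * prob p (E' ∩ Lzᶜ)
      ≤ prob p (E'ᶜ ∩ Lzᶜ ∩ γzᶜ) * prob p (E' ∩ Lz) := by
    have h := partitionThree_lattice hp' ends a₁ a₃ z
    rw [partBCa_eq_three, partAll_eq_ab_ac] at h
    simp only [partABc, partApart, p', prob_update_zero_eq_shift, closeOne_setOf_inter,
      closeOne_setOf_compl] at h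
    simp only [hE', hLz, hγz, e', L', γ']
    linarith [h]
  -- the abstract theorem, and the right-hand side as `ω⁻`-events
  have key := zc_leaf_o hp f (inv e') (inv L') (inv γ') (inv U) (inv U') hE'up hLzup hXzup hX hP1
  simp only at key
  rw [he, hL, hU, hγ]
  simp only [hE', hLz, hγz, hX₀, hXz] at key ⊢
  simp only [p', prob_update_zero_eq_shift, closeOne_setOf_inter, closeOne_setOf_compl]
  exact key

/-- **(L₃) on the graph.**  `a₃` a leaf at `z'` through `f`; `𝓔` an up-set.  With `p' = p[f ↦ 0]`
and `𝓔_{z'} = {S ∣ (z' ∈ S ∧ insert a₃ S ∈ 𝓔) ∨ (z' ∉ S ∧ S ∈ 𝓔)}`: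
  `(ZC)_p(a₁, a₃, o; 𝓔) ≥ (p f)² · (ZC)_{p'}(a₁, z', o; 𝓔_{z'})`. -/
theorem zc_leaf_a3_graph {p : E → R} (hp : IsProbVec p) {ends : E → Sym2 V} {a₁ a₃ o z : V}
    {f : E} (hends : ends f = s(z, a₃)) (hleaf : ∀ e, a₃ ∈ ends e → e = f) (h31 : a₃ ≠ a₁)
    (h3o : a₃ ≠ o) (h3z : a₃ ≠ z) {𝓔 : Set (Set V)} (h𝓔 : IsUpperSet 𝓔) :
    let e := connEvent ends a₁ a₃
    let L := connEvent ends a₁ o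
    let U := clusterInEvent ends a₁ 𝓔
    let γ := connEvent ends a₃ o
    let p' := Function.update p f 0
    let 𝓔z : Set (Set V) := {S | (z ∈ S ∧ insert a₃ S ∈ 𝓔) ∨ (z ∉ S ∧ S ∈ 𝓔)}
    let e' := connEvent ends a₁ z
    let L' := connEvent ends a₁ o
    let U' := clusterInEvent ends a₁ 𝓔z
    let γ' := connEvent ends z o
    prob p (eᶜ ∩ Lᶜ ∩ γᶜ) * (prob p (U ∩ (e ∩ L)) - prob p U * prob p (e ∩ L))
      - prob p (eᶜ ∩ Lᶜ ∩ γ) * (prob p (U ∩ (e ∩ Lᶜ)) - prob p U * prob p (e ∩ Lᶜ))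
      ≥ p f * p f * (prob p' (e'ᶜ ∩ L'ᶜ ∩ γ'ᶜ) * (prob p' (U' ∩ (e' ∩ L')) - prob p' U' * prob p' (e' ∩ L'))
          - prob p' (e'ᶜ ∩ L'ᶜ ∩ γ') * (prob p' (U' ∩ (e' ∩ L'ᶜ)) - prob p' U' * prob p' (e' ∩ L'ᶜ))) := by
  intro e L U γ p' 𝓔z e' L' U' γ'
  have hz3 : z ≠ a₃ := Ne.symm h3z
  set Ez : Set (Config E) := {ω | Function.update ω f false ∈ e'} with hEz
  set L'' : Set (Config E) := {ω | Function.update ω f false ∈ L'} with hL''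
  set γz : Set (Config E) := {ω | Function.update ω f false ∈ γ'} with hγz
  set X₀ : Set (Config E) := {ω | Function.update ω f false ∈ U} with hX₀
  set Xz : Set (Config E) := {ω | Function.update ω f false ∈ U'} with hXz
  have he : e = openEdge f ∩ Ez := by
    ext ω
    simp only [e, Ez, e', Set.mem_inter_iff, Set.mem_setOf_eq, mem_connEvent, mem_openEdge]
    exact conn_leaf_iff hends hleaf hz3 ω (Ne.symm h31)
  have hL : L = L'' := by
    ext ω
    simp only [L, L'', L', Set.mem_setOf_eq, mem_connEvent]
    exact conn_leaf_iff_of_ne hends hleaf hz3 ω (Ne.symm h31) (Ne.symm h3o)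
  have hγ : γ = openEdge f ∩ γz := by
    ext ω
    simp only [γ, γz, γ', Set.mem_inter_iff, Set.mem_setOf_eq, mem_connEvent, mem_openEdge]
    constructor
    · intro h
      obtain ⟨hf, hc⟩ := (conn_leaf_iff hends hleaf hz3 ω (Ne.symm h3o)).1 (conn_symm h)
      exact ⟨hf, conn_symm hc⟩
    · rintro ⟨hf, hc⟩
      exact conn_symm ((conn_leaf_iff hends hleaf hz3 ω (Ne.symm h3o)).2 ⟨hf, conn_symm hc⟩)
  have hU : U = (openEdge f ∩ Xz) ∪ (closedEdge f ∩ X₀) := by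
    ext ω
    simp only [U, Xz, X₀, U', 𝓔z, Set.mem_union, Set.mem_inter_iff, Set.mem_setOf_eq,
      mem_clusterInEvent, mem_openEdge, mem_closedEdge]
    rw [cluster_leaf_eq hends hleaf hz3 ω (Ne.symm h31)]
    rcases Bool.eq_false_or_eq_true (ω f) with hf | hf
    · by_cases hz : z ∈ cluster ends (Function.update ω f false) a₁
      · have hset : cluster ends (Function.update ω f false) a₁
            ∪ {u | u = a₃ ∧ ω f = true ∧ z ∈ cluster ends (Function.update ω f false) a₁}
            = insert a₃ (cluster ends (Function.update ω f false) a₁) := by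
          ext u; simp [hf, hz]
        rw [hset]; simp [hf, hz]
      · have hset : cluster ends (Function.update ω f false) a₁
            ∪ {u | u = a₃ ∧ ω f = true ∧ z ∈ cluster ends (Function.update ω f false) a₁}
            = cluster ends (Function.update ω f false) a₁ := by
          ext u; simp [hz]
        rw [hset]; simp [hf, hz]
    · have hset : cluster ends (Function.update ω f false) a₁
          ∪ {u | u = a₃ ∧ ω f = true ∧ z ∈ cluster ends (Function.update ω f false) a₁}
          = cluster ends (Function.update ω f false) a₁ := by
        ext u; simp [hf]
      rw [hset]; simp [hf]
  have inv : ∀ (A : Set (Config E)) (ω : Config E) (b : Bool),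
      Function.update ω f b ∈ {ω | Function.update ω f false ∈ A} ↔
        ω ∈ {ω | Function.update ω f false ∈ A} := by
    intro A ω b; simp only [Set.mem_setOf_eq, closeOne_update]
  have hEzup : IsUpperSet Ez := fun ω ω' hle hω => conn_mono (closeOne_mono f hle) hω
  have hL''up : IsUpperSet L'' := fun ω ω' hle hω => conn_mono (closeOne_mono f hle) hω
  have h𝓔zup : IsUpperSet 𝓔z := by
    intro S S' hSS' hS
    rcases hS with ⟨hzS, hS⟩ | ⟨hzS, hS⟩
    · exact Or.inl ⟨hSS' hzS, h𝓔 (Set.insert_subset_insert hSS') hS⟩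
    · by_cases hz' : z ∈ S'
      · exact Or.inl ⟨hz', h𝓔 ((hSS'.trans (Set.subset_insert _ _))) hS⟩
      · exact Or.inr ⟨hz', h𝓔 hSS' hS⟩
  have hXzup : IsUpperSet Xz := fun ω ω' hle hω =>
    h𝓔zup (cluster_mono (closeOne_mono f hle) a₁) hω
  have hX : X₀ ⊆ Xz := by
    intro ω hω
    simp only [Xz, X₀, U, U', 𝓔z, Set.mem_setOf_eq, mem_clusterInEvent] at hω ⊢
    by_cases hz : z ∈ cluster ends (Function.update ω f false) a₁
    · exact Or.inl ⟨hz, h𝓔 (Set.subset_insert _ _) hω⟩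
    · exact Or.inr ⟨hz, hω⟩
  have hp' : IsProbVec p' := hp.update f le_rfl zero_le_one
  have hP1 : prob p (Ezᶜ ∩ L''ᶜ ∩ γz) * prob p (Ez ∩ L''ᶜ)
      ≤ prob p (Ezᶜ ∩ L''ᶜ ∩ γzᶜ) * prob p (Ez ∩ L'') := by
    have h := partitionThree_lattice hp' ends a₁ z o
    rw [partBCa_eq_three, partAll_eq_ab_ac] at h
    simp only [partABc, partApart, p', prob_update_zero_eq_shift, closeOne_setOf_inter,
      closeOne_setOf_compl] at h
    simp only [hEz, hL'', hγz, e', L', γ']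
    linarith [h]
  have key := zc_leaf_a3 hp f (inv e') (inv L') (inv γ') (inv U) (inv U') hEzup hL''up hXzup hX hP1
  simp only at key
  rw [he, hL, hU, hγ]
  simp only [hEz, hL'', hγz, hX₀, hXz] at key ⊢
  simp only [p', prob_update_zero_eq_shift, closeOne_setOf_inter, closeOne_setOf_compl]
  exact key

end LeafGraph

end Summit.Ventures.PercRepro2
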